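import Summits.KontsevichZagierPeriods.KontsevichZagierPeriods.Statement
import Summits.KontsevichZagierPeriods.KontsevichZagierPeriods.Theorems.TorsionLogsNeronTorsionSectorStubRealDictionary
import Summits.KontsevichZagierPeriods.KontsevichZagierPeriods.Theorems.InverseLandauTateLiftingRealPeriodSwap
import HarnessLib

/-!
# Stub `stub_flexTorsionData` of line `NeronHeight` (crux `TorsionLogs.NeronTorsionFlex`)

Crux `TorsionLogs.NeronTorsionFlex` (stmt-KontsevichZagierPeriods-13806), registered line
`Cruxes/NeronTorsionFlex/Lines/NeronHeight.lean`, SUPPORT stub `stub_flexTorsionData` (M): the flex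
torsion data of the real curve `Y² = X³ − 7X + 6` (`y² = f(x) = 4x³ − 28x + 24 = 4(x−2)(x−1)(x+3)`,
`e₁ = 2`). The real flex `P = (x_P, √f(x_P)/2)` — `ψ₃(x_P) = 3x_P⁴ − 42x_P² + 72x_P − 49 = 0`,
`x_P > 2` — has order `3`, and its real elliptic logarithm is one third of the real period:
`3·∫_{x_P}^∞ dx/√f = 1·(2∫_2^∞ dx/√f)`.

* Order `3` (pure algebra in Mathlib's group law): the tangent at `P` has slope `ℓ = (3x_P² − 7)/(2y_P)`
  with `ℓ² = 3x_P` exactly when `ψ₃(x_P) = 0`, so `x(2P) = ℓ² − 2x_P = x_P` and `y(2P) = −y_P`,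
  i.e. `2P = −P`; `P ≠ O` and `3` is prime.
* Period third (real Weierstrass dictionary of the tree, `Λ` the real lattice of invariants
  `(g₂, g₃) = (28, −24)`, `X = ℘|ℝ`, `u_P ∈ (0, Ω₀/2)` with `X(u_P) = x_P`): the real duplication
  formula gives `X(2u_P) = x_P = X(u_P)`, hence `2u_P + u_P = Ω₀` (`X u = X v ↔ u ≡ ±v` on `(0, Ω₀)`),
  and `∫_{x_P}^∞ dx/√f = u_P`, `2∫_2^∞ dx/√f = Ω₀`.

References: J. H. Silverman, *The Arithmetic of Elliptic Curves* (2009), III.2.3, Ex. 3.7;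
D. F. Lawden, *Elliptic Functions and Applications* (1989), §6.7–6.12.

prover-fwd2-land-4-g18-0, 2026-08-19.
-/

-- single-conjunct summit: Sub = Summit, so the namespace segment repeats by design (CONVENTIONS §2)
set_option linter.dupNamespace false

noncomputable section

open Set MeasureTheory
open scoped PeriodPair
open Summit.KontsevichZagierPeriods.KontsevichZagierPeriods.Cruxes.NeronTorsionSector.Translation
  (weierstrassPRe_half_eq integral_Ioi_weierstrassPRe_eq weierstrassPRe_two_mul weierstrassPRe_eq_iff)
open Summit.KontsevichZagierPeriods.InverseLandau.RealPeriodSwap (cubic_pos)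

namespace Summit.KontsevichZagierPeriods.KontsevichZagierPeriods.TorsionLogs.NeronHeight

/-- **A flex of `Y² = X³ − 7X + 6` has order `3`** (the curve given by its coefficients
`a₁ = a₂ = a₃ = 0`, `a₄ = −7`): for a nonsingular point `P = (x, y)`, `y > 0`, `y² = x³ − 7x + 6`, with
`ψ₃(x) = 3x⁴ − 42x² + 72x − 49 = 0`, the tangent slope `ℓ = (3x² − 7)/(2y)` has `ℓ² = 3x`, so
`x(2P) = ℓ² − 2x = x`, `y(2P) = −y`, i.e. `2P = −P`; and `P ≠ O`, `3` is prime.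
[cite: SilvermanAEC2009, III.2.3] -/
theorem addOrderOf_eq_three_of_flex {W : WeierstrassCurve.Affine ℝ} (h1 : W.a₁ = 0) (h2 : W.a₂ = 0)
    (h3 : W.a₃ = 0) (h4 : W.a₄ = -28 / 4) {x y : ℝ} (hy0 : 0 < y)
    (hy2 : y ^ 2 = x ^ 3 - 7 * x + 6) (hψ : 3 * x ^ 4 - 42 * x ^ 2 + 72 * x - 49 = 0)
    (hns : W.Nonsingular x y) :
    addOrderOf (WeierstrassCurve.Affine.Point.some x y hns) = 3 := by
  have hnegY : W.negY x y = -y := by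
    rw [WeierstrassCurve.Affine.negY, h1, h3]; ring
  have hyne : y ≠ W.negY x y := by rw [hnegY]; linarith
  -- the tangent slope and the doubling coordinates
  have hℓ : W.slope x x y y = (3 * x ^ 2 - 7) / (2 * y) := by
    rw [WeierstrassCurve.Affine.slope_of_Y_ne rfl hyne, hnegY, h1, h2, h4]
    ring
  have hℓ2 : ((3 * x ^ 2 - 7) / (2 * y)) ^ 2 = 3 * x := by
    rw [div_pow, div_eq_iff (by positivity)]
    nlinarith [hy2, hψ]
  have hX : W.addX x x (W.slope x x y y) = x := by
    rw [WeierstrassCurve.Affine.addX, hℓ, hℓ2, h1, h2]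
    ring
  have hY : W.addY x x y (W.slope x x y y) = W.negY x y := by
    rw [WeierstrassCurve.Affine.addY, WeierstrassCurve.Affine.negAddY, hX, sub_self, mul_zero, zero_add]
  -- `P + P + P = 0`
  have h3P : (3 : ℕ) • (WeierstrassCurve.Affine.Point.some x y hns) = 0 := by
    rw [show (3 : ℕ) = 2 + 1 from rfl, succ_nsmul, two_nsmul,
      WeierstrassCurve.Affine.Point.add_self_of_Y_ne hyne]
    exact WeierstrassCurve.Affine.Point.add_of_Y_eq hX hY
  exact addOrderOf_eq_prime h3P (WeierstrassCurve.Affine.Point.some_ne_zero hns)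

/-- **The real flex of `Y² = X³ − 7X + 6` sits at one third of the real period**: for `x_P > 2`
with `ψ₃(x_P) = 0`, `3·∫_{x_P}^∞ dx/√f = 2∫_2^∞ dx/√f` (`f = 4x³ − 28x + 24`). With `Λ` the real
lattice of invariants `(28, −24)` and `X(u_P) = x_P`, `u_P ∈ (0, Ω₀/2)`: the real duplication formula
and `ψ₃(x_P) = 0` give `X(2u_P) = x_P`, so `2u_P + u_P = Ω₀`. [cite: Lawden1989, §6.12 (6.12.4)] -/
theorem flex_period_third (xP : ℝ) (hxP : 2 < xP)
    (hψ : 3 * xP ^ 4 - 42 * xP ^ 2 + 72 * xP - 49 = 0) :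
    (3 : ℝ) * (∫ x in Set.Ioi xP, (Real.sqrt (4 * x ^ 3 - 28 * x + 24))⁻¹) =
      (1 : ℝ) * (2 * ∫ x in Set.Ioi (2 : ℝ), (Real.sqrt (4 * x ^ 3 - 28 * x + 24))⁻¹) := by
  -- the real lattice with invariants `(g₂, g₃) = (28, -24)`
  obtain ⟨L, hL2, hL3⟩ :=
    PeriodPair.uniformization_holds (28 : ℂ) (-24 : ℂ) (by norm_num)
  have hR : L.IsReal := PeriodPair.isReal_of_g₂_g₃_real PeriodPair.uniformization_unique_holds
    (by rw [hL2]; norm_num) (by rw [hL3]; norm_num)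
  have hg2 : L.g₂.re = 28 := by rw [hL2]; norm_num
  have hg3 : L.g₃.re = -24 := by rw [hL3]; norm_num
  have hfx : ∀ x : ℝ, 4 * x ^ 3 - 28 * x + 24 = 4 * x ^ 3 - L.g₂.re * x - L.g₃.re := by
    intro x; rw [hg2, hg3]; ring
  simp_rw [hfx]
  set T := L.minRealPeriod / 2 with hT
  have hΩ := hR.minRealPeriod_pos
  have hfe : 4 * (2 : ℝ) ^ 3 - L.g₂.re * 2 - L.g₃.re = 0 := by rw [hg2, hg3]; norm_num
  have hpos : ∀ x : ℝ, 2 < x → 0 < 4 * x ^ 3 - L.g₂.re * x - L.g₃.re := by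
    intro x hx; rw [← hfx]; exact cubic_pos hx
  have hXT : L.weierstrassPRe T = 2 := weierstrassPRe_half_eq hR hfe hpos
  -- the parameter `u_P ∈ (0, T)` of the flex
  have hsurj : ∃ u ∈ Ioo 0 T, L.weierstrassPRe u = xP := by
    have hx' : xP ∈ Ioi (L.weierstrassPRe (L.minRealPeriod / 2)) := by rw [← hT, hXT]; exact hxP
    rw [← hR.image_weierstrassPRe_Ioo] at hx'
    obtain ⟨u, hu, rfl⟩ := hx'
    exact ⟨u, hu, rfl⟩
  obtain ⟨uP, huP, hXuP⟩ := hsurj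
  have huP' : uP ∈ Ioo 0 L.minRealPeriod := ⟨huP.1, by rw [hT] at huP; linarith [huP.2]⟩
  have huPne : uP ≠ L.minRealPeriod / 2 := by rw [← hT]; exact huP.2.ne
  have huPn : (uP : ℂ) ∉ L.lattice := hR.ofReal_notMem_lattice huP'.1 huP'.2
  have hY2 : L.derivWeierstrassPRe uP ^ 2 = 4 * xP ^ 3 - L.g₂.re * xP - L.g₃.re := by
    rw [← hXuP]; exact hR.derivWeierstrassPRe_sq huPn
  have hfP : 0 < 4 * xP ^ 3 - L.g₂.re * xP - L.g₃.re := hpos xP hxP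
  have hY0 : L.derivWeierstrassPRe uP ≠ 0 := by
    intro h0; rw [h0] at hY2; nlinarith [hY2]
  -- the real duplication formula: `X(2u_P) = x_P` because `ψ₃(x_P) = 0`
  have hX2 : L.weierstrassPRe (2 * uP) = xP := by
    have hD : 4 * xP ^ 3 - 28 * xP + 24 ≠ 0 := (cubic_pos hxP).ne'
    have hYsq : L.derivWeierstrassPRe uP ^ 2 = 4 * xP ^ 3 - 28 * xP + 24 := by
      rw [hY2, hg2, hg3]; ring
    rw [(weierstrassPRe_two_mul hR huP' huPne).1, hXuP, div_pow, hYsq, hg2, div_div, sub_eq_iff_eq_add,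
      div_eq_iff (mul_ne_zero hD four_ne_zero)]
    linear_combination (-4 : ℝ) * hψ
  have h2uP : 2 * uP ∈ Ioo 0 L.minRealPeriod :=
    ⟨by linarith [huP.1], by rw [hT] at huP; linarith [huP.2]⟩
  have hcases := (weierstrassPRe_eq_iff hR h2uP huP').1 (by rw [hX2, hXuP])
  have hu3 : 3 * uP = L.minRealPeriod := by
    rcases hcases with h | h
    · linarith [huP.1]
    · linarith
  -- the two integrals
  have hω1 : ∫ x in Ioi xP, (Real.sqrt (4 * x ^ 3 - L.g₂.re * x - L.g₃.re))⁻¹ = uP := by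
    rw [← hXuP]; exact integral_Ioi_weierstrassPRe_eq hR ⟨huP.1, huP.2.le⟩
  have hω2 : ∫ x in Ioi (2 : ℝ), (Real.sqrt (4 * x ^ 3 - L.g₂.re * x - L.g₃.re))⁻¹ = T := by
    rw [← hXT, hT]; exact hR.integral_Ioi_inv_sqrt_cubic_eq
  rw [hω1, hω2, hT]
  linarith

/-- **Stub `stub_flexTorsionData` of line `NeronHeight`** (conclusion VERBATIM the body of
`Cruxes.NeronTorsionFlex.NeronHeight.FlexTorsionData`): the real flex of `Y² = X³ − 7X + 6` has order
`3` and real elliptic logarithm `ω₁/3`. [cite: SilvermanAEC2009, III.2.3] -/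
theorem flexTorsionData :
    ∀ (xP : ℝ), 2 < xP → 3 * xP ^ 4 - 42 * xP ^ 2 + 72 * xP - 49 = 0 →
    (∀ hns : (⟨0, 0, 0, -28 / 4, -(-24) / 4⟩ : WeierstrassCurve ℝ).toAffine.Nonsingular xP
        (Real.sqrt (4 * xP ^ 3 - 28 * xP + 24) / 2),
      addOrderOf (WeierstrassCurve.Affine.Point.some xP (Real.sqrt (4 * xP ^ 3 - 28 * xP + 24) / 2) hns)
        = 3) ∧
    (3 : ℝ) * (∫ x in Set.Ioi xP, (Real.sqrt (4 * x ^ 3 - 28 * x + 24))⁻¹) =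
      (1 : ℝ) * (2 * ∫ x in Set.Ioi (2 : ℝ), (Real.sqrt (4 * x ^ 3 - 28 * x + 24))⁻¹) := by
  intro xP hxP hψ
  refine ⟨fun hns => ?_, flex_period_third xP hxP hψ⟩
  have hfP : 0 < 4 * xP ^ 3 - 28 * xP + 24 := cubic_pos hxP
  refine addOrderOf_eq_three_of_flex rfl rfl rfl rfl (div_pos (Real.sqrt_pos.2 hfP) two_pos) ?_ hψ hns
  rw [div_pow, Real.sq_sqrt hfP.le]
  ring

end Summit.KontsevichZagierPeriods.KontsevichZagierPeriods.TorsionLogs.NeronHeight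

end
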